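import Literature.Analysis.FluidPDE.LerayH1Continuation
import Literature.Analysis.FluidPDE.TaoLocalisation
import HarnessLib

/-!
# Tao (2011/2013), Thm. 5.4 (i)–(ii) with Prop. 5.6: the local `H¹` solution from `H¹` data is almost regular

Named fact (D-0014: `def … : Prop`, nothing asserted) from

* T. Tao, *Localisation and compactness properties of the Navier–Stokes global regularity
  problem*, Anal. PDE 6 (2013), 25–107 = arXiv:1108.1165 (`Tao2011`), §5: Thm. 5.4
  (= arXiv Thm. 31, p. 18) items (i) "Strong solution", (ii) "Local existence and regularity",
  and Prop. 5.6 (= arXiv Prop. 33, p. 19) "Almost regularity";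
* J. C. Robinson, J. L. Rodrigo, W. Sadowski, *The Three-Dimensional Navier–Stokes Equations*
  (CUP 2016), Def. 6.1 and Thm. 6.5 (PDF pp. 98, 101): a solution with
  `u ∈ L^∞(0,T;H¹) ∩ L²(0,T;H²)` ("strong") satisfies the energy equality, "in particular, every
  strong solution must also be a Leray–Hopf weak solution" ("valid on all three domains").

It is the smoothing leaf of the decomposition of **ns.S07**
`Literature.Analysis.FluidPDE.ladyzhenskaya_prodi_serrin` (Ladyzhenskaya–Prodi–Serrin; plan in
`NSSerrinRegularity.lean`): the Serrin enstrophy inequality (`SerrinEnstrophyGronwall.lean`,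
proved) is a statement about *classical* solutions in Tao's `L²`-Sobolev class, and this fact is
what puts a Leray–Hopf solution restarted at a good time into that class for positive times.

## The printed statements (`ν = 1`)

Thm. 5.4: "Let `(u₀, f, T)` be `H¹` data. (i) (Strong solution) If `(u, p, u₀, f, T, 1)` is an `H¹`
mild solution, then `u ∈ C⁰_t H¹_x([0,T] × ℝ³)`. (ii) (Local existence and regularity) If
`(‖u₀‖_{H¹_x(ℝ³)} + ‖f‖_{L¹_t H¹_x(ℝ³)})⁴ T ≤ c` for a sufficiently small absolute constant
`c > 0`, then there exists a `H¹` mild solution `(u, p, u₀, f, T)` with the indicated data […]."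
Prop. 5.6: "Let `(u, p, u₀, 0, T)` be a homogeneous `H¹` mild solution obeying (D4) [the
smallness condition of (ii)] for a sufficiently small absolute constant `c > 0`. Then `u, p` are
smooth on `[τ, T] × ℝ³` for all `0 < τ < T`; in fact, all derivatives of `u, p` lie in
`L^∞_t L²_x([τ, T] × ℝ³)`."
Here (Tao2011, §1 p. 6) an *`H¹` mild solution* has `u₀ ∈ H¹_x` divergence free,
`u ∈ L^∞_t H¹_x ∩ L²_t H²_x([0,T] × ℝ³)`, the pressure `p = -Δ⁻¹∂ᵢ∂ⱼ(uᵢuⱼ)` and obeys Duhamel's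
formula; `‖u‖_{H¹_x} = (‖u‖²_{L²} + ‖∇u‖²_{L²})^{1/2}` with Euclidean tensor norms (§2, p. 8).

## Rendering

* Homogeneous case `f = 0`; viscosity `ν > 0` by the rescaling of Tao's footnote 3
  (`v(s, x) = ν⁻¹u(s/ν, x)`, `q = ν⁻²p(s/ν, x)`; `‖v(0)‖_{H¹} = ν⁻¹‖u₀‖_{H¹}`), under which (D4)
  reads `‖u₀‖⁴_{H¹} T ≤ c ν³`; with the squared norm `‖u₀‖²_{H¹} = eH1NormSq u₀ ≤ A` it is asked as
  `A² T ≤ c ν³` (the form of the tree's `LerayLocalStrongH1With`, whose lifespan is in terms of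
  `‖∇u₀‖` alone, Robinson–Rodrigo–Sadowski Thm. 6.15; the present hypothesis is the printed,
  more demanding one).
* `H¹` data: `u₀ ∈ L²`, weakly divergence free, `eH1NormSq u₀ < ∞` (an `L²` weak gradient; the
  accepted weak-gradient `H¹` norm of `CheskidovShvydkoyRegular.lean`, RRS (1.12), equal to Tao's
  up to the unspecified absolute constant `c`).
* The `H¹` mild solution `u` of (ii) is rendered, as in the accepted `leray_local_strong_H1`, by
  its printed consequences used downstream: it is a Leray–Hopf weak solution of the unforced
  system on `ℝ³ × [0, T)` from `u₀` (RRS Thm. 6.5: `L^∞H¹ ∩ L²H²` solutions satisfy the energy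
  equality and are Leray–Hopf; the accepted `IsLerayHopfOn T ν 0 u₀ v`), attains the datum,
  `v 0 = u₀`, and `t ↦ ‖v(t)‖²_{H¹}` is finite and continuous on `[0, T]` (item (i),
  `C⁰_t H¹_x`; the accepted `IsH1RegularOn (Icc 0 T) v`).
* Prop. 5.6 ("smooth on `[τ, T] × ℝ³`, all derivatives of `u, p` in `L^∞_t L²_x([τ, T])`") is
  rendered on each closed slab `[τ, T]`, `0 < τ < T`, by a classical solution `(w, π)` of the
  unforced system (`IsClassicalNSSolutionOn (Icc τ T) ν 0 w π`: jointly `C^∞`, the equations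
  pointwise) with all `L²` Sobolev norms of `w`, of `∂ₜw` (the one-sided time derivative within
  `[τ, T]`) and of `π` bounded on `[τ, T]` (`HasBoundedSobolevNormsOn`, the class of the accepted
  `tao2011_smooth_local_existence`), representing `v`: `v t = w t` a.e. for every `t ∈ [τ, T]`
  (`v` being an honest `L^∞_t H¹_x` function, smoothness is a statement about a representative).
  Only the derivatives of orders used by the Serrin programme are thereby recorded (all spatial
  orders, first order in time); higher time derivatives are not vendored.

Nothing is asserted; users take `(h : tao2011_H1_local_almost_regular)`.

## Mathlib / tree search

Mathlib has no Navier–Stokes theory. Tree (`lean search 'local_strong' / 'smooth_local' /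
'almost'`): `leray_local_strong_H1` (`LerayH1Continuation.lean`: RRS Thm. 6.15, local strong
solutions from `H¹` data, no smoothing), `tao2011_smooth_local_existence`
(`TaoH1LocalExistence.lean`: Thm. 5.4 (ii)+(iv) for smooth `H^∞` data, classical up to `t = 0`),
`local_classical_lerayHopf` (Schwartz data, proved). None gives positive-time smoothness of the
solution issued from a general `H¹` datum, which is what restarting a Leray–Hopf solution at a
good time provides (RRS, remark before Thm. 8.17).

## References

* T. Tao, Anal. PDE 6 (2013) 25–107 = arXiv:1108.1165, §1 (p. 6, `H¹` mild solutions), §5,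
  Thm. 5.4 (arXiv Thm. 31, p. 18), Lemma 5.5 and Prop. 5.6 (arXiv Lemma 32, Prop. 33, pp. 18–19),
  footnote 3 (rescaling). [Tao2011]
* J. C. Robinson, J. L. Rodrigo, W. Sadowski, *The Three-Dimensional Navier–Stokes Equations.
  Classical theory*, CUP 2016, Def. 6.1, p. 99 (`u ∈ C([0,T];H¹)`), Thm. 6.5 (PDF pp. 98–101),
  Thm. 7.5 (the same smoothing for strong solutions, PDF p. 118). [RobinsonRodrigoSadowski2016]
-/

noncomputable section

open MeasureTheory Set
open scoped ENNReal NNReal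

namespace Literature.Analysis.FluidPDE

/-- Local notation for physical space `ℝ³ = EuclideanSpace ℝ (Fin 3)`. -/
local notation "ℝ³" => EuclideanSpace ℝ (Fin 3)

/-- The content of `tao2011_H1_local_almost_regular` with a given smallness constant `c`: for
`ν > 0`, `T > 0` and a divergence-free `u₀ ∈ H¹(ℝ³)` (`u₀ ∈ L²`, weakly divergence free,
`‖u₀‖²_{H¹} = eH1NormSq u₀ ≤ A`) with `A² T ≤ c ν³` (Tao's (D4), rescaled), there is a Leray–Hopf
weak solution `v` of the unforced system on `ℝ³ × [0, T)` from `u₀` with `v 0 = u₀`, whose squared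
`H¹` norm is finite and continuous on `[0, T]` (Thm. 5.4 (i)–(ii)), and which on every closed slab
`[τ, T]`, `0 < τ < T`, is represented by a classical solution `(w, π)` with all `L²` Sobolev norms
of `w`, `∂ₜw`, `π` bounded on `[τ, T]` (Prop. 5.6: "all derivatives of `u, p` lie in
`L^∞_t L²_x([τ,T] × ℝ³)`"). See the module docstring for the rendering. [cite: Tao2011, Thm. 5.4 (i)-(ii) and Prop. 5.6] -/
def TaoH1AlmostRegularWith (c : ℝ) : Prop :=
  ∀ ⦃ν T : ℝ⦄, 0 < ν → 0 < T → ∀ ⦃u₀ : ℝ³ → ℝ³⦄, MemLp u₀ 2 volume → IsWeaklyDivFree u₀ →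
    ∀ ⦃A : ℝ⦄, 0 ≤ A → eH1NormSq u₀ ≤ ENNReal.ofReal A → A ^ 2 * T ≤ c * ν ^ 3 →
      ∃ v : ℝ → ℝ³ → ℝ³, IsLerayHopfOn T ν 0 u₀ v ∧ v 0 = u₀ ∧ IsH1RegularOn (Icc 0 T) v ∧
        ∀ ⦃τ : ℝ⦄, τ ∈ Ioo 0 T → ∃ (w : ℝ → ℝ³ → ℝ³) (π : ℝ → ℝ³ → ℝ),
          IsClassicalNSSolutionOn (Icc τ T) ν 0 w π ∧
          HasBoundedSobolevNormsOn (Icc τ T) w ∧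
          HasBoundedSobolevNormsOn (Icc τ T) (timeDerivWithin (Icc τ T) w) ∧
          (∀ n : ℕ, ∃ C : ℝ≥0, ∀ t ∈ Icc τ T, ∫⁻ x, ‖iteratedFDeriv ℝ n (π t) x‖ₑ ^ 2 ≤ C) ∧
          ∀ t ∈ Icc τ T, v t =ᵐ[volume] w t

/-- **Tao's local `H¹` theory: the local solution from `H¹` data is almost regular**
(Tao 2011/2013, Thm. 5.4 (i)–(ii) with Prop. 5.6, homogeneous case, `ν > 0` by rescaling):
there is an absolute constant `c > 0` such that `TaoH1AlmostRegularWith c` holds — every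
divergence-free `u₀ ∈ H¹(ℝ³)` with `‖u₀‖⁴_{H¹} T ≤ c ν³` issues a Leray–Hopf weak solution on
`[0, T)` attaining `u₀`, `H¹`-continuous on `[0, T]`, and smooth with all `L²` Sobolev norms of
velocity, time derivative and pressure bounded on every `[τ, T] × ℝ³`, `0 < τ < T`. Nothing is
asserted; users take `(h : tao2011_H1_local_almost_regular)`. [cite: Tao2011, Thm. 5.4 (i)-(ii) and Prop. 5.6] -/
def tao2011_H1_local_almost_regular : Prop :=
  ∃ c : ℝ, 0 < c ∧ TaoH1AlmostRegularWith c

/-- Monotonicity in the smallness constant: the statement with constant `c` implies it with any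
`c' ≤ c` (a more demanding smallness hypothesis). [folklore] -/
theorem TaoH1AlmostRegularWith.mono {c c' : ℝ} (h : TaoH1AlmostRegularWith c) (hc : c' ≤ c) :
    TaoH1AlmostRegularWith c' :=
  fun _ν _T hν hT _u₀ hu₀ hdiv _A hA hH1 hsmall =>
    h hν hT hu₀ hdiv hA hH1 (hsmall.trans (mul_le_mul_of_nonneg_right hc (pow_nonneg hν.le 3)))

/-- Forgetting the smoothing clause: `TaoH1AlmostRegularWith c` yields local Leray–Hopf
solutions from `H¹` data which attain the datum and are `H¹`-continuous on `[0, T]`, with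
lifespan controlled by the full `H¹` norm (Thm. 5.4 (i)–(ii) alone; compare
`LerayLocalStrongH1With`, where the lifespan is in terms of `‖∇u₀‖`). [cite: Tao2011, Thm. 5.4 (i)-(ii)] -/
theorem TaoH1AlmostRegularWith.exists_isH1RegularOn {c : ℝ} (h : TaoH1AlmostRegularWith c)
    {ν T : ℝ} (hν : 0 < ν) (hT : 0 < T) {u₀ : ℝ³ → ℝ³} (hu₀ : MemLp u₀ 2 volume)
    (hdiv : IsWeaklyDivFree u₀) {A : ℝ} (hA : 0 ≤ A) (hH1 : eH1NormSq u₀ ≤ ENNReal.ofReal A)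
    (hsmall : A ^ 2 * T ≤ c * ν ^ 3) :
    ∃ v : ℝ → ℝ³ → ℝ³, IsLerayHopfOn T ν 0 u₀ v ∧ v 0 = u₀ ∧ IsH1RegularOn (Icc 0 T) v := by
  obtain ⟨v, hv, hv0, hreg, -⟩ := h hν hT hu₀ hdiv hA hH1 hsmall
  exact ⟨v, hv, hv0, hreg⟩

end Literature.Analysis.FluidPDE

end
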